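import Literature.NumberTheory.Automorphic.Liu2021.AppendixC.HeckeEndomorphism
import Literature.AlgebraicGeometry.Motives.AbelianVarietyEndAlgebraInstances
import HarnessLib

/-!
# [Liu 2021, p. 133 (D.3)] the IMAGE of the Hecke algebra in `End⁰(A_K)` (d6 DEF DH2a) and its faithful `ℓ`-adic realisation

Topic `NumberTheory/Automorphic/Liu2021/AppendixC`; namespace `Literature.NumberTheory.Automorphic.Liu2021.AppendixC.Sec42Data.HeckeTranslates`.
ONE DEFINITION (`heckeImage`) + theorems; no named fact, no instance, no `sorry`.

Print, [Liu2021] p. 133: «We have a homomorphism `C_c^∞(K\G(𝔸^∞)/K, ℚ) → End(A_K)_ℚ` of ℚ-algebras induced by the Hecke actions. … Therefore,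
we obtain an isogeny decomposition `A_K ∼ A_K^st × A_K^end` (D.3) … of `C_c^∞(K\G(𝔸^∞)/K, ℚ)`-modules.»  The decomposition is cut out by
central idempotents of the IMAGE of that homomorphism — the finite-dimensional `ℚ`-subalgebra of `End⁰(A_K)` generated by the Hecke
endomorphisms `[KgK]` (★ `HeckeEndomorphism.heckeEnd`).  This file defines that image and records what the sequel (its semisimplicity, door
(β) of the cell's census `CENSUS-DH1-DH2.A-p09g13.md`: «faithful on a semisimple Hecke module ⇒ semisimple», ★ `SemisimpleOfFaithfulModule` +
★ `SemisimpleBaseChangeDescent`) consumes: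

* `heckeImage T hD K : Subalgebra ℚ (C.A K).endAlgebra := Algebra.adjoin ℚ (range (heckeEnd T hD K))`; `heckeEnd_mem_heckeImage`;
  `module_finite_heckeImage` (a subalgebra of the finite-dimensional `End⁰(A_K)`, ★ `endAlgebra.instModuleFinite`).
* FAITHFULNESS `rationalTateAction_comp_val_injective (ℓ)`: `V_ℓ^ℚ : heckeImage → End_{ℚ_ℓ}(V_ℓ A_K)` is injective (★ `rationalTateAction_injective`,
  Mumford §19 Thm. 3; ★ `linearIndependent_rationalTateAction` is the `ℚ_ℓ ⊗` form the sequel uses).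
* `adjoin_rationalTateAction_heckeEnd_eq (ℓ)`: the `ℚ_ℓ`-subalgebra of `End(V_ℓ A_K)` generated by the `V_ℓ^ℚ [KgK]` IS the one generated by
  `V_ℓ^ℚ(heckeImage)` — the `ℚ_ℓ`-span of a faithful copy of `heckeImage`; its transposes are the Hecke operators `[KgK]` on
  `H¹_ét(A_K) ≅ H¹_ét(A_∞)^K` (★ `toTower_dualMap_rationalTateAction_heckeEnd`), `mem_adjoin_dualMap_of_mem`.

DICTIONARY LINE (cell `hodgecm-mathlib`, crux `HLiu418` = stmt-HodgeConjecture-24832, d6 HOME card S2′): curve tower `hD := isogenyDescent_GS`; the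
S1 clause (3) FACT «`H¹` at level `K` is a semisimple Hecke module» is consumed by the sequel against the subalgebra of this file.  The file moves
no book (HC_CM is proved only modulo the 7 printed citations until rung 0 closes).

## References
* [Liu2021] Y. Liu, *Fourier–Jacobi cycles and arithmetic relative trace formula*, Camb. J. Math. 9 (2021): p. 133 (before and at (D.3), FJcycle.tex
  l. 5463–5464); §4.2 (l. 2074).
* [MumfordAV1970] D. Mumford, *Abelian Varieties*, §19 Thm. 3 and Cor. 1–2 (`End A` finitely generated, `End A → End T_ℓ A` injective).
-/

set_option autoImplicit false

noncomputable section

open CategoryTheory NumberField Function MulAction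
open scoped TensorProduct

namespace Literature.NumberTheory.Automorphic.Liu2021.AppendixC

open Literature.AlgebraicGeometry.Motives (AbelianVariety)
open Literature.AlgebraicGeometry.Motives.AbelianVariety (rationalTateModuleMap endAlgebra rationalTateAction rationalTateAction_algebraMap
  rationalTateAction_injective)

variable {F E : Type} [Field F] [NumberField F] [IsTotallyReal F] [Field E] [NumberField E] [Algebra F E]
  [IsTotallyComplex E] [Algebra.IsQuadraticExtension F E]
variable {P5 : PropC5Data F E} {isotropicAt : ℕ → Prop}

namespace Sec42Data.HeckeTranslates

variable {C : Sec42Data P5 isotropicAt} (T : C.HeckeTranslates)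

/-! ## §1 The definition -/

/-- **DH2a — the image of the Hecke algebra in `End⁰(A_K)`**: the `ℚ`-subalgebra of `End(A_K)_ℚ` generated by the Hecke endomorphisms
`[KgK]`, `g ∈ 𝔾(𝔸_F^∞)` — the image of «the homomorphism `C_c^∞(K\G(𝔸^∞)/K, ℚ) → End(A_K)_ℚ` induced by the Hecke actions».
[cite: Liu2021, p. 133 (before (D.3), FJcycle.tex l. 5463)] -/
def heckeImage (hD : T.IsogenyDescent) (K : C5.SmallLevel C.S.K₀) : Subalgebra ℚ (C.A K).endAlgebra :=
  Algebra.adjoin ℚ (Set.range (T.heckeEnd hD K))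

/-- Each Hecke endomorphism lies in the image. [cite: Liu2021, p. 133 (before (D.3))] -/
theorem heckeEnd_mem_heckeImage (hD : T.IsogenyDescent) (K : C5.SmallLevel C.S.K₀) (g : C.G) :
    T.heckeEnd hD K g ∈ T.heckeImage hD K :=
  Algebra.subset_adjoin ⟨g, rfl⟩

/-- The image is the smallest subalgebra containing the Hecke endomorphisms. [cite: Liu2021, p. 133 (before (D.3))] -/
theorem heckeImage_le_iff (hD : T.IsogenyDescent) (K : C5.SmallLevel C.S.K₀) (S : Subalgebra ℚ (C.A K).endAlgebra) :
    T.heckeImage hD K ≤ S ↔ ∀ g, T.heckeEnd hD K g ∈ S := by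
  rw [heckeImage, Algebra.adjoin_le_iff, Set.range_subset_iff]
  rfl

/-- **The image is a finite-dimensional `ℚ`-algebra** (a subalgebra of `End⁰(A_K)`, which is finite-dimensional: Mumford §19 Cor. 1–2 of
Thm. 3, the tree's instance `endAlgebra.instModuleFinite`). [cite: MumfordAV1970, §19 Cor. 1–2 of Thm. 3] [cite: Liu2021, p. 133 (before (D.3))] -/
theorem module_finite_heckeImage (hD : T.IsogenyDescent) (K : C5.SmallLevel C.S.K₀) : Module.Finite ℚ ↥(T.heckeImage hD K) := by
  -- `End⁰(A_K)` is noetherian over `ℚ` (finite-dimensional); the instances are threaded by hand because instance search does not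
  -- bridge the two `AddCommMonoid` paths on the `def` `endAlgebra` (cf. `AbelianVarietyEndAlgebraInstances`)
  haveI : IsNoetherian ℚ (C.A K).endAlgebra :=
    @isNoetherian_of_isNoetherianRing_of_finite ℚ (C.A K).endAlgebra _
      (Literature.AlgebraicGeometry.Motives.AbelianVariety.endAlgebra.instRing (C.A K)).toAddCommGroup Algebra.toModule _
      (Literature.AlgebraicGeometry.Motives.AbelianVariety.endAlgebra.instModuleFinite (C.A K))
  exact Module.Finite.of_injective (T.heckeImage hD K).val.toLinearMap Subtype.val_injective

/-! ## §2 The faithful `ℓ`-adic realisation -/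

section Etale

variable (ℓ : ℕ) [Fact ℓ.Prime]

/-- `ℓ ≠ 0` in a number field. [folklore] -/
private theorem natCast_ne_zero {L : Type*} [Field L] [NumberField L] : (ℓ : L) ≠ 0 := Nat.cast_ne_zero.2 (Fact.out : ℓ.Prime).ne_zero

/-- **Faithfulness**: the `ℓ`-adic realisation `V_ℓ^ℚ : heckeImage → End_{ℚ_ℓ}(V_ℓ A_K)` is injective (`End⁰(A) → End(V_ℓ A)` is, Mumford §19
Thm. 3). [cite: MumfordAV1970, §19 Thm. 3] -/
theorem rationalTateAction_comp_val_injective (hD : T.IsogenyDescent) (K : C5.SmallLevel C.S.K₀) :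
    Function.Injective ((rationalTateAction (C.A K) ℓ).comp (T.heckeImage hD K).val.toRingHom) :=
  (rationalTateAction_injective (A := C.A K) (ℓ := ℓ) (natCast_ne_zero ℓ (L := E))).comp Subtype.val_injective

/-- The realisation of the image lies in the `ℚ_ℓ`-subalgebra generated by the realised generators `V_ℓ^ℚ [KgK]`.
[cite: Liu2021, p. 133 (before (D.3))] -/
theorem rationalTateAction_mem_adjoin_of_mem (hD : T.IsogenyDescent) (K : C5.SmallLevel C.S.K₀) {x : (C.A K).endAlgebra}
    (hx : x ∈ T.heckeImage hD K) :
    rationalTateAction (C.A K) ℓ x ∈ Algebra.adjoin ℚ_[ℓ] (Set.range fun g => rationalTateAction (C.A K) ℓ (T.heckeEnd hD K g)) := by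
  induction hx using Algebra.adjoin_induction with
  | mem y hy =>
    obtain ⟨g, rfl⟩ := hy
    exact Algebra.subset_adjoin ⟨g, rfl⟩
  | algebraMap q =>
    rw [rationalTateAction_algebraMap]
    exact Subalgebra.algebraMap_mem _ _
  | add y z _ _ hy hz => rw [map_add]; exact add_mem hy hz
  | mul y z _ _ hy hz => rw [map_mul]; exact mul_mem hy hz

/-- **The `ℚ_ℓ`-algebra generated by the `V_ℓ^ℚ [KgK]` is the one generated by `V_ℓ^ℚ(heckeImage)`** (so it is the `ℚ_ℓ`-span of a faithful
copy of `heckeImage`, the object to which «faithful semisimple module ⇒ semisimple» applies). [cite: Liu2021, p. 133 (before (D.3))] -/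
theorem adjoin_rationalTateAction_heckeEnd_eq (hD : T.IsogenyDescent) (K : C5.SmallLevel C.S.K₀) :
    Algebra.adjoin ℚ_[ℓ] (Set.range fun g => rationalTateAction (C.A K) ℓ (T.heckeEnd hD K g)) =
      Algebra.adjoin ℚ_[ℓ] (rationalTateAction (C.A K) ℓ '' (T.heckeImage hD K : Set (C.A K).endAlgebra)) := by
  refine le_antisymm (Algebra.adjoin_mono ?_) (Algebra.adjoin_le ?_)
  · rintro _ ⟨g, rfl⟩
    exact ⟨T.heckeEnd hD K g, T.heckeEnd_mem_heckeImage hD K g, rfl⟩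
  · rintro _ ⟨x, hx, rfl⟩
    exact T.rationalTateAction_mem_adjoin_of_mem ℓ hD K hx

/-- Cohomology side: the transposes `ᵗ(V_ℓ^ℚ x)`, `x ∈ heckeImage`, lie in the `ℚ_ℓ`-subalgebra of `End(H¹_ét(A_K))` generated by the Hecke
operators `ᵗ(V_ℓ^ℚ [KgK]) = [KgK]` (★ `toTower_dualMap_rationalTateAction_heckeEnd`). [cite: Liu2021, p. 133 (before (D.3)) and §4.2 (l. 2074)] -/
theorem dualMap_rationalTateAction_mem_adjoin_of_mem (hD : T.IsogenyDescent) (K : C5.SmallLevel C.S.K₀) {x : (C.A K).endAlgebra}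
    (hx : x ∈ T.heckeImage hD K) :
    (rationalTateAction (C.A K) ℓ x).dualMap ∈
      Algebra.adjoin ℚ_[ℓ] (Set.range fun g => (rationalTateAction (C.A K) ℓ (T.heckeEnd hD K g)).dualMap) := by
  induction hx using Algebra.adjoin_induction with
  | mem y hy =>
    obtain ⟨g, rfl⟩ := hy
    exact Algebra.subset_adjoin ⟨g, rfl⟩
  | algebraMap q =>
    have h1 : (rationalTateAction (C.A K) ℓ (algebraMap ℚ (C.A K).endAlgebra q)).dualMap =
        algebraMap ℚ_[ℓ] (Module.End ℚ_[ℓ] (C.etaleH1 ℓ K)) (algebraMap ℚ ℚ_[ℓ] q) := by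
      rw [rationalTateAction_algebraMap]
      ext φ v
      simp [LinearMap.dualMap_apply, Algebra.algebraMap_eq_smul_one]
    rw [h1]
    exact Subalgebra.algebraMap_mem _ _
  | add y z _ _ hy hz =>
    have h1 : (rationalTateAction (C.A K) ℓ (y + z)).dualMap =
        (rationalTateAction (C.A K) ℓ y).dualMap + (rationalTateAction (C.A K) ℓ z).dualMap := by
      rw [map_add]
      ext φ v
      simp [LinearMap.dualMap_apply]
    rw [h1]
    exact add_mem hy hz
  | mul y z _ _ hy hz =>
    rw [map_mul, Module.End.mul_eq_comp, ← LinearMap.dualMap_comp_dualMap]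
    exact mul_mem hz hy

end Etale

end Sec42Data.HeckeTranslates

end Literature.NumberTheory.Automorphic.Liu2021.AppendixC

end
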